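import Summits.HubbardSuperconductivity.HubbardSuperconductivity.Theorems.SoloBlindSectorGibbsTransfer
import Summits.HubbardSuperconductivity.HubbardSuperconductivity.Theorems.SoloBlindPenaltyTransfer
import HarnessLib

/-!
# `HubbardSuperconductivity` from a positive-temperature bound at an explicit temperature scale

Solo programme `solo-HubbardSuperconductivity-blind`, structural Theorem 18, part (c). Write
`H_L = hubbardTorus 2 L 1 U`, `O_L = (√2Δ_d)†(√2Δ_d) = (pairField dWaveFormFactor L)ᴴ pairField …`,
`K_L` = the doped sector `(N = 2⌊(1-δ)L²/2⌋, S^z = 0)`, `D_L = dim K_L ≤ 4^{L²}`, and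
`⟨·⟩_{L,β,s}` = the canonical `K_L`-sector Gibbs average of the PENALISED `H_L + s O_L`.

* `hubbardSuperconductivity_of_penalised_thermal_entropy` — **sufficiency at an explicit
  temperature.** If for some `U > 0`, `δ ∈ (0,1/2)`, `c > 0`, `L₀`, at every even side `L ≥ L₀`
  there are `s > 0` and ONE inverse temperature `β > 0` with
  `β · s ≥ 4 log 2 / (c L²)` and `re ⟨O_L⟩_{L,β,s} ≥ c L⁴`, then `HubbardSuperconductivity` (every
  ground state of the unpenalised `H_L` has d-wave order `≥ (c/2) L⁴`). Theorem 17's thermal form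
  needed the bound for all large `β` at each `L` (a rate hidden in the unknown sector gap); the
  entropy price `log D_L/(βs) ≤ 2 L² log 2/(βs)` replaces "`β → ∞` first" by ONE temperature.
* `penalised_thermal_entropy_of_hubbardSuperconductivity` — **necessity**: the summit gives such
  `s_L`, `β_L` (from the certificate form, `s = c/(1600(κ_L+1))`,
  `β = 8(κ_L+1)(1+1600/c)/(c L²)`), and `hubbardSuperconductivity_iff_penalised_thermal_entropy`
  — the equivalence. The zero-temperature, every-ground-state summit is a statement about ONE
  canonical Gibbs state per side at inverse temperature `β_L` with `β_L s_L c L² ≥ 4 log 2`.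

Remark (the scale). Gauge-twist softness (Theorem 2, `SoloBlindTwistSoftness`) forces
`s_L = O(t/(c L⁴))` whenever a penalised ground or Gibbs state keeps order `c L⁴`, so the
hypothesis lives at `β_L = Ω(L²/t)`: colder than any `L`-independent temperature (where
Koma–Tasaki excludes the order) but, unlike Theorems 10/17, at a TYPED temperature with no gap and
no uniqueness input; an entropy bound `S(ρ_{β,L}) ≤ C L²/β` for the sector Gibbs state would
lower the scale to `β_L = Ω(L)`. [this work]
-/

noncomputable section

namespace Summit.HubbardSuperconductivity.HubbardSuperconductivity.Theorems

open Matrix Filter Topology Literature.Probability.LatticeModels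
  Literature.MathematicalPhysics.QuantumLattice
  Literature.MathematicalPhysics.QuantumLattice.EigenvalueContinuation
open scoped ComplexOrder

/-! ### The dimension of a sector -/

/-- `log dim K ≤ 2 L² log 2` for every subspace `K` of the Fock space of the `L × L` torus
(`dim Fock = 2^{|Orb|} = 2^{2L²}`). [folklore] -/
theorem log_finrank_submodule_fock_le (n : ℕ)
    (K : Submodule ℂ (Fock (Orb (FermionTorus 2 (n + 1))))) :
    Real.log (Module.finrank ℂ K) ≤ 2 * ((n + 1 : ℕ) : ℝ) ^ 2 * Real.log 2 := by
  have hT : Fintype.card (FermionTorus 2 (n + 1)) = (n + 1) ^ 2 := by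
    simp [FermionTorus, Fintype.card_lex]
  have h1 : Module.finrank ℂ K ≤ 2 ^ (2 * (n + 1) ^ 2) := by
    calc Module.finrank ℂ K ≤ Module.finrank ℂ (Fock (Orb (FermionTorus 2 (n + 1)))) :=
          Submodule.finrank_le K
      _ = Fintype.card (Finset (Orb (FermionTorus 2 (n + 1)))) :=
          Module.finrank_fintype_fun_eq_card ℂ
      _ = 2 ^ (2 * (n + 1) ^ 2) := by rw [Fintype.card_finset, card_orb, hT]
  rcases Nat.eq_zero_or_pos (Module.finrank ℂ K) with h0 | hpos
  · rw [h0, Nat.cast_zero, Real.log_zero]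
    positivity
  · calc Real.log (Module.finrank ℂ K) ≤ Real.log ((2 : ℝ) ^ (2 * (n + 1) ^ 2)) :=
          Real.log_le_log (by exact_mod_cast hpos) (by exact_mod_cast h1)
      _ = 2 * ((n + 1 : ℕ) : ℝ) ^ 2 * Real.log 2 := by
          rw [Real.log_pow]; push_cast; ring

/-! ### The summit from one temperature per side -/

section Summit

/-- **Theorem 18 (sufficiency): `HubbardSuperconductivity` from ONE positive-temperature bound per
side, at the explicit scale `β s ≥ 4 log 2 / (c L²)`.** If for some `U > 0`, `δ ∈ (0,1/2)`, `c > 0`,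
`L₀`, at every even side `L = n+1 ≥ L₀` there are `s > 0` and `β > 0` with
`4 log 2 ≤ β s c L²` such that the canonical Gibbs state of the doped sector for the penalised
`H_L + s (√2Δ_d)†(√2Δ_d)` has `c L⁴ ≤ re (tr (P_K e^{-β(H_L+sO)} O) / tr (P_K e^{-β(H_L+sO)}))`,
then `HubbardSuperconductivity` — with constant `c/2`, for EVERY ground state of the unpenalised
`H_L`; no gap, uniqueness, or `β → ∞` input (`groundState_re_rayleigh_ge_of_sectorGibbs_penalised`
and `log dim K ≤ 2 L² log 2`). [this work] -/
theorem hubbardSuperconductivity_of_penalised_thermal_entropy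
    (h : ∃ U : ℝ, 0 < U ∧ ∃ δ ∈ Set.Ioo (0 : ℝ) (1 / 2), ∃ c : ℝ, 0 < c ∧ ∃ L₀ : ℕ,
      ∀ n : ℕ, Even (n + 1) → L₀ ≤ n + 1 → ∃ s : ℝ, 0 < s ∧ ∃ β : ℝ, 0 < β ∧
        4 * Real.log 2 ≤ β * s * c * ((n + 1 : ℕ) : ℝ) ^ 2 ∧
        c * ((n + 1 : ℕ) : ℝ) ^ 4 ≤
          ((projMatrix ((szSector (Λ := FermionTorus 2 (n + 1))
                (2 * ⌊(1 - δ) * ((n + 1 : ℕ) : ℝ) ^ 2 / 2⌋₊) 0).map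
                ((WithLp.linearEquiv 2 ℂ (Fock (Orb (FermionTorus 2 (n + 1))))).symm :
                  Fock (Orb (FermionTorus 2 (n + 1))) →ₗ[ℂ]
                    EuclideanSpace ℂ (Finset (Orb (FermionTorus 2 (n + 1)))))) *
              gibbsWeight β (hubbardTorus 2 (n + 1) 1 U + (s : ℂ) •
                ((pairField dWaveFormFactor (n + 1))ᴴ * pairField dWaveFormFactor (n + 1))) *
              ((pairField dWaveFormFactor (n + 1))ᴴ * pairField dWaveFormFactor (n + 1))).trace /
            (projMatrix ((szSector (Λ := FermionTorus 2 (n + 1))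
                (2 * ⌊(1 - δ) * ((n + 1 : ℕ) : ℝ) ^ 2 / 2⌋₊) 0).map
                ((WithLp.linearEquiv 2 ℂ (Fock (Orb (FermionTorus 2 (n + 1))))).symm :
                  Fock (Orb (FermionTorus 2 (n + 1))) →ₗ[ℂ]
                    EuclideanSpace ℂ (Finset (Orb (FermionTorus 2 (n + 1)))))) *
              gibbsWeight β (hubbardTorus 2 (n + 1) 1 U + (s : ℂ) •
                ((pairField dWaveFormFactor (n + 1))ᴴ *
                  pairField dWaveFormFactor (n + 1)))).trace).re) :
    HubbardSuperconductivity := by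
  obtain ⟨U, hU, δ, hδ, c, hc, L₀, hb⟩ := h
  refine hubbardSuperconductivity_of_uniform_dWave_bound
    ⟨U, hU, δ, hδ, c / 2, by positivity, L₀, fun n hn hL φ hφ1 hgs => ?_⟩
  obtain ⟨s, hs, β, hβ, htemp, hth⟩ := hb n hn hL
  obtain ⟨hN2, hKne⟩ := dopedSector_two_le_and_ne_bot U hδ hn
  set N : ℕ := 2 * ⌊(1 - δ) * ((n + 1 : ℕ) : ℝ) ^ 2 / 2⌋₊ with hN
  set K : Submodule ℂ (Fock (Orb (FermionTorus 2 (n + 1)))) := szSector N 0 with hK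
  set H := hubbardTorus 2 (n + 1) 1 U with hH
  set O := (pairField dWaveFormFactor (n + 1))ᴴ * pairField dWaveFormFactor (n + 1) with hO
  have hKA : ∀ v ∈ K, H *ᵥ v ∈ K := fun v hv => hubbardTorus_mulVec_mem_szSector 1 U hv
  have hKO : ∀ v ∈ K, O *ᵥ v ∈ K := by
    intro v hv
    rw [hO, ← mulVec_mulVec]
    have h := PairTower.pairField_conjTranspose_mulVec_mem_szSector dWaveFormFactor
      (PairTower.pairField_mulVec_mem_szSector dWaveFormFactor hv)
    rwa [Nat.sub_add_cancel hN2] at h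
  have hφ := groundState_re_rayleigh_ge_of_sectorGibbs_penalised
    (isHermitian_hubbardTorus (n + 1) 1 U) (isHermitian_conjTranspose_mul_self _) K hKA hKO hs hβ
    hth hgs.1 hφ1 hgs.2.2
  have hlog := log_finrank_submodule_fock_le n K
  have hβs : 0 < β * s := mul_pos hβ hs
  have hL2 : (0 : ℝ) ≤ ((n + 1 : ℕ) : ℝ) ^ 2 := by positivity
  have hprice : Real.log (Module.finrank ℂ K) / (β * s) ≤ c * ((n + 1 : ℕ) : ℝ) ^ 4 / 2 := by
    rw [div_le_iff₀ hβs]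
    have h2 := mul_le_mul_of_nonneg_right htemp hL2
    calc Real.log (Module.finrank ℂ K) ≤ 2 * ((n + 1 : ℕ) : ℝ) ^ 2 * Real.log 2 := hlog
      _ ≤ β * s * c * ((n + 1 : ℕ) : ℝ) ^ 2 * ((n + 1 : ℕ) : ℝ) ^ 2 / 2 := by linarith
      _ = c * ((n + 1 : ℕ) : ℝ) ^ 4 / 2 * (β * s) := by ring
  change c / 2 * ((n + 1 : ℕ) : ℝ) ^ 4 ≤ (star φ ⬝ᵥ (O *ᵥ φ)).re
  linarith

/-- **Theorem 18 (necessity).** `HubbardSuperconductivity` ⟹ for some `U > 0`, `δ ∈ (0,1/2)`,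
`c > 0`, `L₀`, at every even side `L = n+1 ≥ L₀` there are `s > 0`, `β > 0` with
`4 log 2 ≤ β s c L²` and `c L⁴ ≤ re ⟨(√2Δ_d)†(√2Δ_d)⟩` in the canonical Gibbs state of the doped
sector for `H_L + s (√2Δ_d)†(√2Δ_d)` at inverse temperature `β` (certificate form with multiplier
`κ_L`; `s = c₀/(1600(κ_L+1))`, `β = 8(κ_L+1)(1+1600/c₀)/(c₀L²)`, `c = c₀/2`;
`re_sectorGibbs_penalised_ge_of_certificate`). [this work] -/
theorem penalised_thermal_entropy_of_hubbardSuperconductivity (hS : HubbardSuperconductivity) :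
    ∃ U : ℝ, 0 < U ∧ ∃ δ ∈ Set.Ioo (0 : ℝ) (1 / 2), ∃ c : ℝ, 0 < c ∧ ∃ L₀ : ℕ,
      ∀ n : ℕ, Even (n + 1) → L₀ ≤ n + 1 → ∃ s : ℝ, 0 < s ∧ ∃ β : ℝ, 0 < β ∧
        4 * Real.log 2 ≤ β * s * c * ((n + 1 : ℕ) : ℝ) ^ 2 ∧
        c * ((n + 1 : ℕ) : ℝ) ^ 4 ≤
          ((projMatrix ((szSector (Λ := FermionTorus 2 (n + 1))
                (2 * ⌊(1 - δ) * ((n + 1 : ℕ) : ℝ) ^ 2 / 2⌋₊) 0).map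
                ((WithLp.linearEquiv 2 ℂ (Fock (Orb (FermionTorus 2 (n + 1))))).symm :
                  Fock (Orb (FermionTorus 2 (n + 1))) →ₗ[ℂ]
                    EuclideanSpace ℂ (Finset (Orb (FermionTorus 2 (n + 1)))))) *
              gibbsWeight β (hubbardTorus 2 (n + 1) 1 U + (s : ℂ) •
                ((pairField dWaveFormFactor (n + 1))ᴴ * pairField dWaveFormFactor (n + 1))) *
              ((pairField dWaveFormFactor (n + 1))ᴴ * pairField dWaveFormFactor (n + 1))).trace /
            (projMatrix ((szSector (Λ := FermionTorus 2 (n + 1))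
                (2 * ⌊(1 - δ) * ((n + 1 : ℕ) : ℝ) ^ 2 / 2⌋₊) 0).map
                ((WithLp.linearEquiv 2 ℂ (Fock (Orb (FermionTorus 2 (n + 1))))).symm :
                  Fock (Orb (FermionTorus 2 (n + 1))) →ₗ[ℂ]
                    EuclideanSpace ℂ (Finset (Orb (FermionTorus 2 (n + 1)))))) *
              gibbsWeight β (hubbardTorus 2 (n + 1) 1 U + (s : ℂ) •
                ((pairField dWaveFormFactor (n + 1))ᴴ *
                  pairField dWaveFormFactor (n + 1)))).trace).re := by
  obtain ⟨U, hU, δ, hδ, c, hc, L₀, hb⟩ := hubbardSuperconductivity_iff_certificate.mp hS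
  refine ⟨U, hU, δ, hδ, c / 2, by positivity, L₀, fun n hn hL => ?_⟩
  obtain ⟨κ, hκ, hcert⟩ := hb n hn hL
  obtain ⟨hN2, hKne⟩ := dopedSector_two_le_and_ne_bot U hδ hn
  set N : ℕ := 2 * ⌊(1 - δ) * ((n + 1 : ℕ) : ℝ) ^ 2 / 2⌋₊ with hN
  set K : Submodule ℂ (Fock (Orb (FermionTorus 2 (n + 1)))) := szSector N 0 with hK
  set H := hubbardTorus 2 (n + 1) 1 U with hH
  set O := (pairField dWaveFormFactor (n + 1))ᴴ * pairField dWaveFormFactor (n + 1) with hO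
  have hκ1 : 0 < κ + 1 := by linarith
  have hLpos : (0 : ℝ) < ((n + 1 : ℕ) : ℝ) := by positivity
  have hc0 : c ≠ 0 := hc.ne'
  have hκ0 : κ + 1 ≠ 0 := hκ1.ne'
  have hL0 : ((n + 1 : ℕ) : ℝ) ≠ 0 := hLpos.ne'
  have hlog2 : Real.log 2 ≤ 1 := by
    have := Real.log_le_sub_one_of_pos (zero_lt_two : (0 : ℝ) < 2); linarith
  set s : ℝ := c / (1600 * (κ + 1)) with hs_def
  set β : ℝ := 8 * (κ + 1) * (1 + 1600 / c) / (c * ((n + 1 : ℕ) : ℝ) ^ 2) with hβ_def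
  have hgc : 0 < 1 + 1600 / c := by positivity
  have hs : 0 < s := by positivity
  have hβ : 0 < β := by positivity
  refine ⟨s, hs, β, hβ, ?_, ?_⟩
  · have h1 : β * s * (c / 2) * ((n + 1 : ℕ) : ℝ) ^ 2 = c / 400 + 4 := by
      rw [hβ_def, hs_def]
      field_simp
      ring
    rw [h1]
    linarith [hc.le]
  · have hKA : ∀ v ∈ K, H *ᵥ v ∈ K := fun v hv => hubbardTorus_mulVec_mem_szSector 1 U hv
    have hKO : ∀ v ∈ K, O *ᵥ v ∈ K := by
      intro v hv
      rw [hO, ← mulVec_mulVec]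
      have h := PairTower.pairField_conjTranspose_mulVec_mem_szSector dWaveFormFactor
        (PairTower.pairField_mulVec_mem_szSector dWaveFormFactor hv)
      rwa [Nat.sub_add_cancel hN2] at h
    have hB : ∀ ψ ∈ K, star ψ ⬝ᵥ ψ = 1 →
        (star ψ ⬝ᵥ O *ᵥ ψ).re ≤ 400 * ((n + 1 : ℕ) : ℝ) ^ 4 := by
      intro ψ _ hψ1
      have h := pairField_order_le dWaveFormFactor GaugeTwist.abs_dWaveFormFactor_le_one ψ
      rw [hψ1, Complex.one_re, mul_one] at h
      rwa [hO, ← mulVec_mulVec, dotProduct_mulVec, ← star_mulVec]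
    have key := re_sectorGibbs_penalised_ge_of_certificate (isHermitian_hubbardTorus (n + 1) 1 U)
      (isHermitian_conjTranspose_mul_self _) K hKA hKO hKne
      (fun v => re_expect_pairField_nonneg dWaveFormFactor n v) hB hκ hcert hs hβ
    have hlog : Real.log (Module.finrank ℂ K) ≤ 2 * ((n + 1 : ℕ) : ℝ) ^ 2 := by
      have h := log_finrank_submodule_fock_le n K
      have hL2 : (0 : ℝ) ≤ 2 * ((n + 1 : ℕ) : ℝ) ^ 2 := by positivity
      nlinarith
    have hA1 : κ * (s * (400 * ((n + 1 : ℕ) : ℝ) ^ 4)) ≤ c * ((n + 1 : ℕ) : ℝ) ^ 4 / 4 := by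
      have e : κ * (s * (400 * ((n + 1 : ℕ) : ℝ) ^ 4)) =
          κ / (κ + 1) * (c * ((n + 1 : ℕ) : ℝ) ^ 4 / 4) := by
        rw [hs_def]
        field_simp
        ring
      have hfrac : κ / (κ + 1) ≤ 1 := by rw [div_le_one hκ1]; linarith
      rw [e]
      exact mul_le_of_le_one_left (by positivity) hfrac
    have hA2 : κ * (Real.log (Module.finrank ℂ K) / β) ≤ c * ((n + 1 : ℕ) : ℝ) ^ 4 / 4 := by
      have h1 : κ * (Real.log (Module.finrank ℂ K) / β) ≤
          κ * (2 * ((n + 1 : ℕ) : ℝ) ^ 2 / β) :=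
        mul_le_mul_of_nonneg_left (div_le_div_of_nonneg_right hlog hβ.le) hκ
      have e : κ * (2 * ((n + 1 : ℕ) : ℝ) ^ 2 / β) =
          κ / ((κ + 1) * (1 + 1600 / c)) * (c * ((n + 1 : ℕ) : ℝ) ^ 4 / 4) := by
        rw [hβ_def]
        field_simp
        ring
      have hfrac : κ / ((κ + 1) * (1 + 1600 / c)) ≤ 1 := by
        rw [div_le_one (mul_pos hκ1 hgc)]
        have : 1 ≤ 1 + 1600 / c := by
          have := div_pos (by norm_num : (0 : ℝ) < 1600) hc; linarith
        nlinarith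
      rw [e] at h1
      exact h1.trans (mul_le_of_le_one_left (by positivity) hfrac)
    have e2 : c / 2 * ((n + 1 : ℕ) : ℝ) ^ 4 = c * ((n + 1 : ℕ) : ℝ) ^ 4 / 2 := by ring
    rw [e2]
    have hsum : κ * (s * (400 * ((n + 1 : ℕ) : ℝ) ^ 4) + Real.log (Module.finrank ℂ K) / β) ≤
        c * ((n + 1 : ℕ) : ℝ) ^ 4 / 2 := by rw [mul_add]; linarith
    linarith

/-- **Theorem 18: `HubbardSuperconductivity` ⟺ a one-temperature-per-side thermal statement for the
penalised model, at the explicit scale `β_L s_L ≥ 4 log 2/(c L²)`.** [this work] -/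
theorem hubbardSuperconductivity_iff_penalised_thermal_entropy :
    HubbardSuperconductivity ↔
      ∃ U : ℝ, 0 < U ∧ ∃ δ ∈ Set.Ioo (0 : ℝ) (1 / 2), ∃ c : ℝ, 0 < c ∧ ∃ L₀ : ℕ,
        ∀ n : ℕ, Even (n + 1) → L₀ ≤ n + 1 → ∃ s : ℝ, 0 < s ∧ ∃ β : ℝ, 0 < β ∧
          4 * Real.log 2 ≤ β * s * c * ((n + 1 : ℕ) : ℝ) ^ 2 ∧
          c * ((n + 1 : ℕ) : ℝ) ^ 4 ≤
            ((projMatrix ((szSector (Λ := FermionTorus 2 (n + 1))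
                  (2 * ⌊(1 - δ) * ((n + 1 : ℕ) : ℝ) ^ 2 / 2⌋₊) 0).map
                  ((WithLp.linearEquiv 2 ℂ (Fock (Orb (FermionTorus 2 (n + 1))))).symm :
                    Fock (Orb (FermionTorus 2 (n + 1))) →ₗ[ℂ]
                      EuclideanSpace ℂ (Finset (Orb (FermionTorus 2 (n + 1)))))) *
                gibbsWeight β (hubbardTorus 2 (n + 1) 1 U + (s : ℂ) •
                  ((pairField dWaveFormFactor (n + 1))ᴴ * pairField dWaveFormFactor (n + 1))) *
                ((pairField dWaveFormFactor (n + 1))ᴴ *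
                  pairField dWaveFormFactor (n + 1))).trace /
              (projMatrix ((szSector (Λ := FermionTorus 2 (n + 1))
                  (2 * ⌊(1 - δ) * ((n + 1 : ℕ) : ℝ) ^ 2 / 2⌋₊) 0).map
                  ((WithLp.linearEquiv 2 ℂ (Fock (Orb (FermionTorus 2 (n + 1))))).symm :
                    Fock (Orb (FermionTorus 2 (n + 1))) →ₗ[ℂ]
                      EuclideanSpace ℂ (Finset (Orb (FermionTorus 2 (n + 1)))))) *
                gibbsWeight β (hubbardTorus 2 (n + 1) 1 U + (s : ℂ) •
                  ((pairField dWaveFormFactor (n + 1))ᴴ *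
                    pairField dWaveFormFactor (n + 1)))).trace).re :=
  ⟨penalised_thermal_entropy_of_hubbardSuperconductivity,
    hubbardSuperconductivity_of_penalised_thermal_entropy⟩

end Summit

end Summit.HubbardSuperconductivity.HubbardSuperconductivity.Theorems

end
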